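import Literature.NumberTheory.Transcendental.RoySmallValuePhiPoly
import HarnessLib

/-!
# Roy's small value estimate for `𝔾ₐ × 𝔾ₘ` — the length of `F = Φ(P, Q, ·)`

Topic `Literature/NumberTheory/Transcendental`. Part of the formalisation of the proof of Roy 2013,
Theorem 1.1 (named fact `roy2013_thm_1_1`, `RoySmallValueEstimates.lean`). Source: D. Roy,
*A small value estimate for `𝔾ₐ × 𝔾ₘ`*, Mathematika 59 (2013) 333–363 = arXiv:1301.0663, §6,
proof of Proposition 6.4 (p. 17 of the arXiv text):

> [...] this polynomial has integer coefficients and that its norm satisfies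
> `‖F‖ ≤ N! ‖P‖^N ‖Q‖^N ≤ N^N exp(2NY) ≤ exp(6D²Y)`.

For `F = royF D M₁ M₂ σ P Q` (`Φ(P, Q, ·)` as a polynomial in the coefficients `(r_ν)` of the
last argument, `RoySmallValuePhiPoly`) over `ℂ` we prove the corresponding bound for the LENGTH
`𝓛(F) = ∑ |coefficients|` (which dominates the norm and is what the Gelfond–Mahler inequality of
this development consumes): `𝓛(F) ≤ N! · ‖P‖^{N₀} · ‖Q‖^{N₁}` (`l1Norm_royF_le`), `N = #rows`,
`N₀, N₁` the numbers of columns of the `P`- and `Q`-blocks, `‖·‖` the maximum modulus of the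
coefficients — by the Leibniz expansion of the determinant (`l1Norm_det_le`): each entry of the
`P`/`Q` columns is a constant (a coefficient of `P`/`Q`), each entry of the `R` columns a variable
or `0`. Also `l1Norm_map_intCast` identifies `𝓛` of the complexification of an integer polynomial
with `∑ |integer coefficients|`. Everything is proved; no definitions, no named facts.

## References

* [Roy2013] D. Roy, *A small value estimate for 𝔾ₐ × 𝔾ₘ*, Mathematika 59 (2013), 333–363
  (arXiv:1301.0663), §6, proof of Proposition 6.4 (`‖F‖ ≤ N!‖P‖^N‖Q‖^N`).
-/

noncomputable section

open MvPolynomial Finset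

namespace Literature.NumberTheory.Transcendental

namespace Roy2013

open Nesterenko

/-! ### Lengths -/

/-- `𝓛` of the complexification of an integer polynomial is `∑ |coefficients|`. [folklore] -/
theorem l1Norm_map_intCast {τ : Type*} (F₀ : MvPolynomial τ ℤ) :
    l1Norm (map (Int.castRingHom ℂ) F₀) = ∑ m ∈ F₀.support, |((coeff m F₀ : ℤ) : ℝ)| := by
  classical
  rw [l1Norm, support_map_of_injective _ Int.cast_injective]
  refine Finset.sum_congr rfl fun m _ => ?_
  rw [coeff_map, eq_intCast, Complex.norm_intCast]

/-- `𝓛(ε F) = 𝓛(F)` for a sign `ε = ±1`. [folklore] -/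
theorem l1Norm_units_smul {τ : Type*} (ε : ℤˣ) (F : MvPolynomial τ ℂ) : l1Norm (ε • F) = l1Norm F := by
  rcases Int.units_eq_one_or ε with h | h
  · rw [h, one_smul]
  · rw [h, Units.smul_def, Units.val_neg, Units.val_one, neg_smul, one_smul, l1Norm_neg]

/-- **Leibniz bound for the length of a determinant of polynomials**: if `𝓛(N_{ij}) ≤ b_j` then
`𝓛(det N) ≤ n! ∏_j b_j`. [folklore] -/
theorem l1Norm_det_le {n τ : Type*} [Fintype n] [DecidableEq n] (N : Matrix n n (MvPolynomial τ ℂ))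
    (b : n → ℝ) (hb : ∀ i j, l1Norm (N i j) ≤ b j) :
    l1Norm N.det ≤ (Fintype.card n).factorial * ∏ j, b j := by
  have hb0 : ∀ j, 0 ≤ b j := fun j => (l1Norm_nonneg _).trans (hb j j)
  rw [Matrix.det_apply]
  refine (l1Norm_sum_le _ _).trans ?_
  calc ∑ π : Equiv.Perm n, l1Norm (Equiv.Perm.sign π • ∏ i, N (π i) i)
      ≤ ∑ _π : Equiv.Perm n, ∏ j, b j := Finset.sum_le_sum fun π _ => by
        rw [l1Norm_units_smul]
        refine (l1Norm_prod_le _ _).trans ?_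
        exact prod_le_prod (fun i _ => l1Norm_nonneg _) fun i _ => hb _ _
    _ = (Fintype.card n).factorial * ∏ j, b j := by
        rw [sum_const, card_univ, Fintype.card_perm, nsmul_eq_mul]

/-! ### The length of `F` -/

variable {D : ℕ} {M₁ M₂ : Finset (Fin 3 →₀ ℕ)}

/-- The bound for the entries, by block. [folklore] -/
def colBound (P Q : CX) : PhiCol D M₁ M₂ → ℝ :=
  fun c => ![maxNorm P, maxNorm Q, 1] (colBlock c)

/-- Entries of the specialised generic matrix have length at most `colBound`. [folklore] -/
theorem l1Norm_aeval_genEntry_le (P Q : CX) (e : PhiRow D) (c : PhiCol D M₁ M₂) :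
    l1Norm (aeval (phiSpec (D := D) P Q) (genEntry D M₁ M₂ e c)) ≤ colBound P Q c := by
  have hcb0 : 0 ≤ colBound P Q c := by
    rw [colBound]
    rcases c with a | m | m <;> simp [colBlock, maxNorm_nonneg]
  rw [genEntry]
  split_ifs with h
  · rw [aeval_X, phiSpec, colBound]
    rcases c with a | m | m
    · simp only [colBlock, Sum.elim_inl, Matrix.cons_val_zero, l1Norm_C]
      exact norm_coeff_le_maxNorm _ _
    · simp only [colBlock, Sum.elim_inr, Sum.elim_inl, Matrix.cons_val_one, Matrix.cons_val_zero,
        l1Norm_C]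
      exact norm_coeff_le_maxNorm _ _
    · simp only [colBlock, Sum.elim_inr, Matrix.cons_val_two, Matrix.tail_cons, Matrix.head_cons,
        l1Norm_X]
      exact le_rfl
  · rw [map_zero, l1Norm, support_zero, sum_empty]
    exact hcb0

/-- **`𝓛(F) ≤ N! ‖P‖^{N₀} ‖Q‖^{N₁}`** for `F = Φ(P, Q, ·)` over `ℂ`.
[cite: Roy2013, §6, proof of Prop. 6.4 (`‖F‖ ≤ N!‖P‖^N‖Q‖^N`)] -/
theorem l1Norm_royF_le (σ : PhiCol D M₁ M₂ ≃ PhiRow D) (P Q : CX) :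
    l1Norm (royF D M₁ M₂ σ P Q) ≤ (Fintype.card (PhiRow D)).factorial *
      (maxNorm P ^ Fintype.card ↥(finsuppAntidiag (univ : Finset (Fin 3)) (2 * D)) *
        maxNorm Q ^ Fintype.card ↥M₁) := by
  classical
  rw [royF, royPhiPoly, AlgHom.map_det]
  refine (l1Norm_det_le _ (fun j => colBound P Q (σ.symm j)) fun i j => ?_).trans ?_
  · rw [AlgHom.mapMatrix_apply, Matrix.map_apply, Matrix.reindex_apply, Matrix.submatrix_apply,
      Equiv.refl_symm, Equiv.refl_apply, Matrix.of_apply]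
    exact l1Norm_aeval_genEntry_le P Q _ _
  · refine mul_le_mul_of_nonneg_left (le_of_eq ?_) (by positivity)
    rw [Equiv.prod_comp σ.symm (fun c => colBound P Q c), Fintype.prod_sum_type,
      Fintype.prod_sum_type]
    have h0 : ∀ a : ↥(finsuppAntidiag (univ : Finset (Fin 3)) (2 * D)),
        colBound (M₁ := M₁) (M₂ := M₂) P Q (Sum.inl a) = maxNorm P := fun a => by
      simp [colBound, colBlock]
    have h1 : ∀ m : ↥M₁, colBound (D := D) (M₂ := M₂) P Q (Sum.inr (Sum.inl m)) = maxNorm Q :=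
      fun m => by simp [colBound, colBlock]
    have h2 : ∀ m : ↥M₂, colBound (D := D) (M₁ := M₁) P Q (Sum.inr (Sum.inr m)) = 1 :=
      fun m => by simp [colBound, colBlock]
    simp_rw [h0, h1, h2]
    rw [prod_const, prod_const, prod_const_one, mul_one, card_univ, card_univ]

end Roy2013

end Literature.NumberTheory.Transcendental
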